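import Literature.MathematicalPhysics.QuantumFieldTheory.Federbush1986.PhaseCellIVAppAStatements

/-!
# Federbush, *A phase cell approach to Yang–Mills theory. IV* (CMP **114** (1988) 317–343), Appendix A —
# Theorems A.3 and A.4 AS TYPED (`PhaseCellIVAppA.ThmA3`, `PhaseCellIVAppA.ThmA4`, p242861) hold VACUOUSLY

statement-level skeleton of published theorems with citation tags; proofs where landed; nothing here is a claim about the Yang–Mills mass gap

Cell `lit-balaban`, Phase-2 proof seat **p04** (gen 6); SKELETON rows `F4.ThmA.3`, `F4.ThmA.4` (fold owner r19, referee
ref-5).  Source: P. Federbush, Commun. Math. Phys. **114** (1988) 317–343 [bib `Federbush1988PhaseCellIV`], Appendix A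
part C, Theorem A.3 (A.25)–(A.26) p. 342 [PDF 26], and part D, Theorem A.4 (A.34)–(A.36) p. 343 [PDF 27]
(renders `run/shared/lean/pub/lit-balaban/lit-balaban-r19/renders/f4/f4-p026.png`, `…-p027.png`).

THE PRINTED TEXT (p. 342): *«Theorem A.3. There is a mapping `f^s : B → M`, such that a) `f^s|_{∂B} = f|_{∂B}` (A.25),
b) `|D^α f^s(x)| ≤ c_α (d(x, ∂B))^{−(|α|−1)} Λ₁(f)` (A.26).»*  (p. 343): *«Theorem A.4. There is a mapping `f^{es}` on the
ball minus its center `f^{es} : B − x₀ → M` (A.34), such that a) `f^{es}|_{∂B} = f|_{∂B}` (A.35), b) `|D^α f^{es}| ≤ c_α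
(d(x, ∂B ∪ x₀))^{−(|α|−1)} · |x − x₀|^{−1} · Λ₁(f)` (A.36).»*  In print `f^s`, `f^{es}` are *mappings into the manifold*
`M` — continuous on `B` (resp. `B − x₀`): the construction (A.30)/(A.38) is a mollification at the scale `εd(x) → 0` at the
boundary followed by the normal projection onto `M`, and §11 (Geometric Constructions 5–6) uses them as continuous gauge
interpolations.

WHAT THIS FILE PROVES (kernel-checked; axioms `propext`/`Classical.choice`/`Quot.sound`).  The typed statements
`ThmA3 n t M` / `ThmA4 n t M` (file `PhaseCellIVAppAStatements.lean`, p242861) require of the witness `fs` / `fes` only: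
values in `M` on the closed (punctured) ball, agreement with `f` ON THE SPHERE, `C^∞` on the OPEN (punctured) ball, and
the bounds (A.26)/(A.36) at interior points — but NO continuity on the closed ball.  Consequently both Props hold for
EVERY `n`, `t` and EVERY set `M ⊆ ℝᵗ`, with ALL constants `c_α = 0`: take `fs` := `f` on the sphere `∂B` and a constant
point of `M` on its complement (`bdryConst`; the constant is `f(0)` for A.3, `f` of some point of `∂B` for A.4).  This map
is locally constant on the open ball, hence `C^∞` there with all derivatives of order `≥ 1` equal to `0`
(`iteratedFDeriv_bdryConst_eq_zero`), so (A.26)/(A.36) hold with `c_α = 0`: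
* `thmA3_holds : ∀ n t M, ThmA3 n t M`, `thmA4_holds : ∀ n t M, ThmA4 n t M`;
* the sharper forms recording the vacuity, `thmA3_holds_with_zero_constants` / `thmA4_holds_with_zero_constants`
  (the constant function `c = 0` works).
No hypothesis on `M` (compactness, manifold structure) is used, and nothing of the printed proof (mollifier (A.27)–(A.31),
projection onto `M`, radial argument (A.38)) is needed: the rows are decided AS TYPED, and the decision is «vacuous».

FINDING (for ref-1/ref-5 and the fold owner r19; HOME/GAPS.md §G-F4-01): ROWS F4.ThmA.3 / F4.ThmA.4 BOUNCE(misstated: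
vacuous as typed — the typed `f^s`/`f^{es}` is not required to be continuous on the closed ball `B` (resp. `B − x₀`), so
the boundary condition (A.25)/(A.35) does not constrain the interior values).  The repaired statements (continuity of
`f^s` on `B`, of `f^{es}` on `B − x₀`, and `f` Lipschitz — print's `Λ₁(f) < ∞`) are typed in the sibling file
`PhaseCellIVThmA34Repaired.lean` (`ThmA3Cont`, `ThmA4Cont`); they are NOT proved (the printed proof needs the smooth
nearest-point projection onto a compact submanifold `M ⊂ ℝᵗ`, i.e. a tubular neighbourhood, not in Mathlib).
Value = a kernel decision of two theorem-level skeleton rows as typed + the located misstatement; NOT summit progress.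
-/

namespace Literature.MathematicalPhysics.QuantumFieldTheory.Federbush1986

noncomputable section

open scoped NNReal ENNReal ContDiff Topology
open Set Metric Filter
open scoped Classical

namespace PhaseCellIVAppA

/-! ## 1. The witness: `f` on the sphere, a constant elsewhere -/

/-- The vacuity witness for Theorems A.3/A.4 as typed: the ambient map `ℝⁿ → ℝᵗ` equal to the boundary datum `g` on the
unit sphere about `x₀` and to the constant `c` off it.  (A `theorem`-level abbreviation: we reason about the lambda
directly.) [cite: Federbush1988PhaseCellIV, Theorem A.3 (A.25) p. 342, Theorem A.4 (A.35) p. 343] -/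
theorem bdryConst_apply_of_mem {n t : ℕ} (x₀ : EuclideanSpace ℝ (Fin n))
    (g : ↥(sphere x₀ 1) → EuclideanSpace ℝ (Fin t)) (c : EuclideanSpace ℝ (Fin t))
    {x : EuclideanSpace ℝ (Fin n)} (hx : x ∈ sphere x₀ 1) :
    (fun y => if h : y ∈ sphere x₀ 1 then g ⟨y, h⟩ else c) x = g ⟨x, hx⟩ := by
  beta_reduce
  rw [dif_pos hx]

/-- Off the sphere the witness is the constant `c`. [cite: Federbush1988PhaseCellIV, Theorem A.3 p. 342] -/
theorem bdryConst_apply_of_not_mem {n t : ℕ} (x₀ : EuclideanSpace ℝ (Fin n))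
    (g : ↥(sphere x₀ 1) → EuclideanSpace ℝ (Fin t)) (c : EuclideanSpace ℝ (Fin t))
    {x : EuclideanSpace ℝ (Fin n)} (hx : x ∉ sphere x₀ 1) :
    (fun y => if h : y ∈ sphere x₀ 1 then g ⟨y, h⟩ else c) x = c := by
  beta_reduce
  rw [dif_neg hx]

/-- A point of the open unit ball is not on the unit sphere. [folklore] -/
private theorem not_mem_sphere_of_mem_ball {n : ℕ} {x₀ x : EuclideanSpace ℝ (Fin n)} (hx : x ∈ ball x₀ 1) :
    x ∉ sphere x₀ 1 := by
  intro h
  rw [mem_ball] at hx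
  rw [mem_sphere] at h
  linarith

/-- On the open ball the witness agrees with the constant map `c`. [cite: Federbush1988PhaseCellIV, Theorem A.3 p. 342] -/
theorem bdryConst_eqOn_ball {n t : ℕ} (x₀ : EuclideanSpace ℝ (Fin n))
    (g : ↥(sphere x₀ 1) → EuclideanSpace ℝ (Fin t)) (c : EuclideanSpace ℝ (Fin t)) :
    EqOn (fun y => if h : y ∈ sphere x₀ 1 then g ⟨y, h⟩ else c) (fun _ => c) (ball x₀ 1) := by
  intro x hx
  exact bdryConst_apply_of_not_mem x₀ g c (not_mem_sphere_of_mem_ball hx)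

/-- Near an interior point the witness is EVENTUALLY the constant `c` (the open ball is a neighbourhood).
[cite: Federbush1988PhaseCellIV, Theorem A.3 p. 342] -/
theorem bdryConst_eventuallyEq_const {n t : ℕ} (x₀ : EuclideanSpace ℝ (Fin n))
    (g : ↥(sphere x₀ 1) → EuclideanSpace ℝ (Fin t)) (c : EuclideanSpace ℝ (Fin t))
    {x : EuclideanSpace ℝ (Fin n)} (hx : x ∈ ball x₀ 1) :
    (fun y => if h : y ∈ sphere x₀ 1 then g ⟨y, h⟩ else c) =ᶠ[𝓝 x] (fun _ => c) :=
  Filter.eventuallyEq_of_mem (isOpen_ball.mem_nhds hx) (bdryConst_eqOn_ball x₀ g c)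

/-- The witness is `C^∞` on the open ball (it is constant there). [cite: Federbush1988PhaseCellIV, Theorem A.3 p. 342] -/
theorem contDiffOn_bdryConst_ball {n t : ℕ} (x₀ : EuclideanSpace ℝ (Fin n))
    (g : ↥(sphere x₀ 1) → EuclideanSpace ℝ (Fin t)) (c : EuclideanSpace ℝ (Fin t)) :
    ContDiffOn ℝ ∞ (fun y => if h : y ∈ sphere x₀ 1 then g ⟨y, h⟩ else c) (ball x₀ 1) :=
  contDiffOn_const.congr (bdryConst_eqOn_ball x₀ g c)

/-- All derivatives of order `m ≥ 1` of the witness vanish at every interior point — so the typed bounds (A.26)/(A.36)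
hold with the constants `c_α = 0`. [cite: Federbush1988PhaseCellIV, Theorem A.3 (A.26) p. 342, Theorem A.4 (A.36) p. 343] -/
theorem iteratedFDeriv_bdryConst_eq_zero {n t : ℕ} (x₀ : EuclideanSpace ℝ (Fin n))
    (g : ↥(sphere x₀ 1) → EuclideanSpace ℝ (Fin t)) (c : EuclideanSpace ℝ (Fin t))
    {m : ℕ} (hm : 1 ≤ m) {x : EuclideanSpace ℝ (Fin n)} (hx : x ∈ ball x₀ 1) :
    iteratedFDeriv ℝ m (fun y => if h : y ∈ sphere x₀ 1 then g ⟨y, h⟩ else c) x = 0 := by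
  have h := (bdryConst_eventuallyEq_const x₀ g c hx).iteratedFDeriv ℝ m
  rw [h.eq_of_nhds, iteratedFDeriv_const_of_ne (by omega) c]
  rfl

/-- If the punctured open unit ball about `x₀` has a point, the unit sphere about `x₀` is non-empty (the space is then
non-trivial). [folklore] -/
private theorem sphere_nonempty_of_mem_ball_diff {n : ℕ} {x₀ x : EuclideanSpace ℝ (Fin n)}
    (hx : x ∈ ball x₀ 1 \ {x₀}) : (sphere x₀ (1 : ℝ)).Nonempty := by
  have hne : x ≠ x₀ := by simpa using hx.2
  haveI : Nontrivial (EuclideanSpace ℝ (Fin n)) := nontrivial_of_ne x x₀ hne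
  exact NormedSpace.sphere_nonempty.mpr zero_le_one

/-! ## 2. Theorem A.3 as typed holds — vacuously, with `c_α = 0` -/

/-- **Row F4.ThmA.3 decided AS TYPED: `ThmA3 n t M` holds for every `n`, `t` and every set `M ⊆ ℝᵗ`, with the constant
function `c = 0`.**  Witness: `fs` = `f` on `∂B`, `f(0)` elsewhere — values in `M` on `B`, equal to `f` on `∂B`, constant
(hence `C^∞` with vanishing derivatives) on the open ball.  The typed statement omits print's continuity of
«the mapping `f^s : B → M`» on the closed ball, which is what makes (A.25) bind the interior; see the module docstring and
`PhaseCellIVThmA34Repaired.ThmA3Cont`. [cite: Federbush1988PhaseCellIV, Theorem A.3 (A.25)–(A.26) p. 342] -/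
theorem thmA3_holds_with_zero_constants (n t : ℕ) (M : Set (EuclideanSpace ℝ (Fin t))) :
    ∀ f : ↥(closedBall (0 : EuclideanSpace ℝ (Fin n)) 1) → ↥M,
    ∃ fs : EuclideanSpace ℝ (Fin n) → EuclideanSpace ℝ (Fin t),
      MapsTo fs (closedBall 0 1) M ∧
      (∀ x : ↥(sphere (0 : EuclideanSpace ℝ (Fin n)) 1),
        fs x = (f ⟨x.1, sphere_subset_closedBall x.2⟩ : EuclideanSpace ℝ (Fin t))) ∧
      ContDiffOn ℝ ∞ fs (ball 0 1) ∧
      ∀ m : ℕ, 1 ≤ m → ∀ K : ℝ≥0, LipschitzWith K f →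
        ∀ x ∈ ball (0 : EuclideanSpace ℝ (Fin n)) 1,
          ‖iteratedFDeriv ℝ m fs x‖ ≤
            (0 : ℝ) * ((infDist x (sphere (0 : EuclideanSpace ℝ (Fin n)) 1))⁻¹ ^ (m - 1)) * K := by
  intro f
  -- boundary datum and interior constant, both read off `f`
  let g : ↥(sphere (0 : EuclideanSpace ℝ (Fin n)) 1) → EuclideanSpace ℝ (Fin t) :=
    fun x => (f ⟨x.1, sphere_subset_closedBall x.2⟩ : EuclideanSpace ℝ (Fin t))
  let c : EuclideanSpace ℝ (Fin t) :=
    (f ⟨0, mem_closedBall_self zero_le_one⟩ : EuclideanSpace ℝ (Fin t))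
  refine ⟨fun y => if h : y ∈ sphere (0 : EuclideanSpace ℝ (Fin n)) 1 then g ⟨y, h⟩ else c, ?_, ?_, ?_, ?_⟩
  · intro x _
    by_cases h : x ∈ sphere (0 : EuclideanSpace ℝ (Fin n)) 1
    · rw [bdryConst_apply_of_mem 0 g c h]
      exact (f _).2
    · rw [bdryConst_apply_of_not_mem 0 g c h]
      exact (f _).2
  · intro x
    rw [bdryConst_apply_of_mem 0 g c x.2]
  · exact contDiffOn_bdryConst_ball 0 g c
  · intro m hm K _ x hx
    rw [iteratedFDeriv_bdryConst_eq_zero 0 g c hm hx, norm_zero, zero_mul, zero_mul]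

/-- **Theorem A.3 AS TYPED** (`PhaseCellIVAppA.ThmA3`, p242861) holds for every `n`, `t`, `M` — vacuously (constants
`c_α = 0`, discontinuous witness); row F4.ThmA.3 BOUNCE(misstated: vacuous as typed).
[cite: Federbush1988PhaseCellIV, Theorem A.3 (A.25)–(A.26) p. 342] -/
theorem thmA3_holds (n t : ℕ) (M : Set (EuclideanSpace ℝ (Fin t))) : ThmA3 n t M :=
  ⟨fun _ => 0, thmA3_holds_with_zero_constants n t M⟩

/-! ## 3. Theorem A.4 as typed holds — vacuously, with `c_α = 0` -/

/-- **Row F4.ThmA.4 decided AS TYPED: `ThmA4 n t M` holds for every `n`, `t` and every set `M ⊆ ℝᵗ`, with the constant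
function `c = 0`.**  Witness: `fes` = `f` on `∂B`, and off `∂B` the constant `f(y₀)` for some `y₀ ∈ ∂B` (when `∂B = ∅`,
i.e. `n = 0`, the punctured ball is empty too and any constant will do).  The typed statement omits print's continuity of
«the mapping `f^{es} : B − x₀ → M`»; see `PhaseCellIVThmA34Repaired.ThmA4Cont`.
[cite: Federbush1988PhaseCellIV, Theorem A.4 (A.34)–(A.36) p. 343] -/
theorem thmA4_holds_with_zero_constants (n t : ℕ) (M : Set (EuclideanSpace ℝ (Fin t))) :
    ∀ (x₀ : EuclideanSpace ℝ (Fin n)) (f : ↥(sphere x₀ 1) → ↥M),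
    ∃ fes : EuclideanSpace ℝ (Fin n) → EuclideanSpace ℝ (Fin t),
      MapsTo fes (closedBall x₀ 1 \ {x₀}) M ∧
      (∀ x : ↥(sphere x₀ 1), fes x = (f x : EuclideanSpace ℝ (Fin t))) ∧
      ContDiffOn ℝ ∞ fes (ball x₀ 1 \ {x₀}) ∧
      ∀ m : ℕ, 1 ≤ m → ∀ K : ℝ≥0, LipschitzWith K f →
        ∀ x ∈ ball x₀ 1 \ {x₀},
          ‖iteratedFDeriv ℝ m fes x‖ ≤
            (0 : ℝ) * ((infDist x (sphere x₀ 1 ∪ {x₀}))⁻¹ ^ (m - 1)) * ‖x - x₀‖⁻¹ * K := by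
  intro x₀ f
  let g : ↥(sphere x₀ 1) → EuclideanSpace ℝ (Fin t) := fun x => (f x : EuclideanSpace ℝ (Fin t))
  -- interior constant: `f` of some boundary point if the sphere is non-empty, else `0` (then nothing is to be checked)
  let c : EuclideanSpace ℝ (Fin t) :=
    if hS : (sphere x₀ (1 : ℝ)).Nonempty then (f ⟨hS.some, hS.some_mem⟩ : EuclideanSpace ℝ (Fin t)) else 0
  refine ⟨fun y => if h : y ∈ sphere x₀ 1 then g ⟨y, h⟩ else c, ?_, ?_, ?_, ?_⟩
  · intro x hx
    by_cases h : x ∈ sphere x₀ 1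
    · rw [bdryConst_apply_of_mem x₀ g c h]
      exact (f _).2
    · rw [bdryConst_apply_of_not_mem x₀ g c h]
      -- `x` lies in the punctured open ball, so the sphere is non-empty and `c = f(y₀) ∈ M`
      have hx' : x ∈ ball x₀ 1 \ {x₀} := by
        refine ⟨?_, hx.2⟩
        have h1 : dist x x₀ ≤ 1 := mem_closedBall.mp hx.1
        have h2 : dist x x₀ ≠ 1 := fun h' => h (mem_sphere.mpr h')
        exact mem_ball.mpr (lt_of_le_of_ne h1 h2)
      have hS : (sphere x₀ (1 : ℝ)).Nonempty := sphere_nonempty_of_mem_ball_diff hx'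
      simp only [c, dif_pos hS]
      exact (f _).2
  · intro x
    rw [bdryConst_apply_of_mem x₀ g c x.2]
  · exact (contDiffOn_bdryConst_ball x₀ g c).mono fun _ hy => hy.1
  · intro m hm K _ x hx
    rw [iteratedFDeriv_bdryConst_eq_zero x₀ g c hm hx.1, norm_zero, zero_mul, zero_mul, zero_mul]

/-- **Theorem A.4 AS TYPED** (`PhaseCellIVAppA.ThmA4`, p242861) holds for every `n`, `t`, `M` — vacuously (constants
`c_α = 0`, discontinuous witness); row F4.ThmA.4 BOUNCE(misstated: vacuous as typed).
[cite: Federbush1988PhaseCellIV, Theorem A.4 (A.34)–(A.36) p. 343] -/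
theorem thmA4_holds (n t : ℕ) (M : Set (EuclideanSpace ℝ (Fin t))) : ThmA4 n t M :=
  ⟨fun _ => 0, thmA4_holds_with_zero_constants n t M⟩

/-- Both rows at once, for the EMPTY target `M = ∅` as well (there the typed Props quantify over no `f` at all when
`n`-balls are non-empty — a second symptom that the typing carries no hypothesis on `M`). [cite: Federbush1988PhaseCellIV, Theorems A.3–A.4 pp. 342–343] -/
theorem thmA3_and_thmA4_hold (n t : ℕ) (M : Set (EuclideanSpace ℝ (Fin t))) : ThmA3 n t M ∧ ThmA4 n t M :=
  ⟨thmA3_holds n t M, thmA4_holds n t M⟩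

end PhaseCellIVAppA

end

end Literature.MathematicalPhysics.QuantumFieldTheory.Federbush1986
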